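import Mathlib.LinearAlgebra.FreeModule.PID
import Mathlib.LinearAlgebra.Dimension.Free
import Mathlib.LinearAlgebra.Dimension.Constructions
import Mathlib.LinearAlgebra.Finsupp.LinearCombination
import Mathlib.GroupTheory.OrderOfElement
import Mathlib.RingTheory.PrincipalIdealDomain
import Mathlib.LinearAlgebra.InvariantBasisNumber
import Mathlib.LinearAlgebra.FreeModule.StrongRankCondition
import Mathlib.Algebra.EuclideanDomain.Int
import Mathlib.RingTheory.Noetherian.Basic
import Mathlib.LinearAlgebra.FreeModule.Finite.Basic
import Mathlib.RingTheory.Finiteness.Basic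
import HarnessLib

/-!
# Crux `FrobeniusLadder.FRationalResolution` (stmt-ResolutionOfSingularities-15317), line `redirect`,
# stub `stub_diagonalizableQuotientResolution` — the exponent lattice `ker(ℤⁿ → A')` of the monomial
# chart has a `ℤ`-basis of size `n` (chart normalisation R4, third brick; also the source of the
# unit-twist `λ : Pᵍᵖ → T^×` in the torsor descent R3)

For `a : Fin n → A'` with every `aᵢ` of finite order, the kernel `K` of `m ↦ Σ mᵢ aᵢ` on `ℤⁿ`
contains `N ℤⁿ` (`N = ∏ ord aᵢ`), hence has rank `n`; being a subgroup of `ℤⁿ` it is free. So there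
is an injective `ℤ`-linear `L : ℤⁿ → ℤⁿ` with image exactly `K` — the re-parametrisation that
makes the chart monoid `P = ℤⁿ_{≥0} ⊓ K` spanning and saturated (`…LogChartTransport`,
`…ChartMonoidFG`), and the free basis on which unit twists are prescribed.

* `finrank_ker_linearCombination` — `finrank ℤ K = n`;
* `exists_linearMap_range_eq_ker` — `∃ L : ℤⁿ →ₗ[ℤ] ℤⁿ`, injective, `range L = K`.

Honest label: bookkeeping brick (no stub closed). No definitions, no named facts, no sorry.
[folklore; cite: Kato1994, (1.5)]
-/

-- single-problem summit: the doubled namespace component is forced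
set_option linter.dupNamespace false

namespace Summit.ResolutionOfSingularities.ResolutionOfSingularities.Theorems.FRationalResolution.KernelLattice

universe w

variable {A' : Type w} [AddCommGroup A'] {n : ℕ} (a : Fin n → A')

/-- `N ℤⁿ ⊆ ker (m ↦ Σ mᵢ aᵢ)` for `N = ∏ ord aᵢ`. [folklore] -/
theorem range_smul_le_ker (ha : ∀ i, IsOfFinAddOrder (a i)) :
    LinearMap.range ((∏ i, addOrderOf (a i) : ℤ) • (LinearMap.id : (Fin n → ℤ) →ₗ[ℤ] (Fin n → ℤ)))
      ≤ LinearMap.ker (Fintype.linearCombination ℤ a) := by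
  have _ := ha
  have hN : ∀ i, (∏ j, (addOrderOf (a j) : ℤ)) • a i = 0 := fun i => by
    rw [← Nat.cast_prod, natCast_zsmul]
    obtain ⟨c, hc⟩ := Finset.dvd_prod_of_mem (fun j => addOrderOf (a j)) (Finset.mem_univ i)
    rw [hc, mul_nsmul, addOrderOf_nsmul_eq_zero, smul_zero]
  rintro _ ⟨v, rfl⟩
  rw [LinearMap.mem_ker, LinearMap.smul_apply, LinearMap.id_apply, map_zsmul,
    Fintype.linearCombination_apply, Finset.smul_sum]
  refine Finset.sum_eq_zero fun i _ => ?_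
  rw [smul_comm, hN i, smul_zero]

/-- **The exponent lattice has rank `n`.** [folklore] -/
theorem finrank_ker_linearCombination (ha : ∀ i, IsOfFinAddOrder (a i)) :
    Module.finrank ℤ (LinearMap.ker (Fintype.linearCombination ℤ a)) = n := by
  apply le_antisymm
  · calc Module.finrank ℤ (LinearMap.ker (Fintype.linearCombination ℤ a))
        ≤ Module.finrank ℤ (Fin n → ℤ) := Submodule.finrank_le _
      _ = n := Module.finrank_fin_fun ℤ
  · have hN : ((∏ i, addOrderOf (a i) : ℕ) : ℤ) ≠ 0 := by
      rw [Int.natCast_ne_zero, Finset.prod_ne_zero_iff]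
      exact fun i _ => (ha i).addOrderOf_pos.ne'
    have hinj : Function.Injective
        (((∏ i, addOrderOf (a i) : ℕ) : ℤ) • (LinearMap.id : (Fin n → ℤ) →ₗ[ℤ] (Fin n → ℤ))) :=
      fun v w h => smul_right_injective (Fin n → ℤ) hN (by simpa using h)
    calc n = Module.finrank ℤ (Fin n → ℤ) := (Module.finrank_fin_fun ℤ).symm
      _ = Module.finrank ℤ (LinearMap.range
            (((∏ i, addOrderOf (a i) : ℕ) : ℤ) • (LinearMap.id : (Fin n → ℤ) →ₗ[ℤ] (Fin n → ℤ)))) :=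
          (LinearMap.finrank_range_of_inj hinj).symm
      _ ≤ Module.finrank ℤ (LinearMap.ker (Fintype.linearCombination ℤ a)) :=
          Submodule.finrank_mono (by exact_mod_cast range_smul_le_ker a ha)

/-- **A `ℤ`-basis of the exponent lattice, as an injective linear endomorphism of `ℤⁿ` with image
`ker (m ↦ Σ mᵢ aᵢ)`.** [folklore] -/
theorem exists_linearMap_range_eq_ker (ha : ∀ i, IsOfFinAddOrder (a i)) :
    ∃ L : (Fin n → ℤ) →ₗ[ℤ] (Fin n → ℤ), Function.Injective L ∧
      LinearMap.range L = LinearMap.ker (Fintype.linearCombination ℤ a) := by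
  set K := LinearMap.ker (Fintype.linearCombination ℤ a) with hK
  haveI : Module.Finite ℤ K := Module.Finite.of_injective K.subtype K.injective_subtype
  haveI : Module.Free ℤ K := Module.free_of_finite_type_torsion_free'
  let b := Module.finBasisOfFinrankEq ℤ K (finrank_ker_linearCombination a ha)
  refine ⟨K.subtype ∘ₗ (b.equivFun.symm : (Fin n → ℤ) →ₗ[ℤ] K), ?_, ?_⟩
  · exact K.injective_subtype.comp b.equivFun.symm.injective
  · rw [LinearMap.range_comp, LinearEquiv.range, Submodule.map_top, Submodule.range_subtype]

end Summit.ResolutionOfSingularities.ResolutionOfSingularities.Theorems.FRationalResolution.KernelLattice
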